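import Summits.Schanuel.Schanuel.Theorems.RootDecomp1KGeneric09

/-!
# RootDecomp1K — «GENERIC CELLS», part 10: Piece KS (Kummer specialisation) — budget lemmas and extracted steps

Provenance: ROOT DECOMPOSITION CELL decomp-schanuel (D-0178), lens 6 «barrier-complement carving»,
gen 13, Stage D; source `KS.lean` (lens publication dir `decomp-schanuel-lens-6/g13/addendum/`).
Supports `stmt-Schanuel-33363` (A₄ʰ `HyperLiouvilleSchanuel`) via the glued split of
`Theorems/RootDecomp1KGeneric02` (`hyperLiouvilleSchanuel_live_of_pieces`): this series of parts 08–11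
PROVES Piece KS (`KummerSpecialisation`, `@[conjecture] def` of part 01) outright.

Contents: §8 root-separation and size budgets (`budget_pairSize`: `Λ(f,S) ≤ q^{4E+16}`); §9 generic extracted
steps of the main proof (common exponent bound, closeness of coordinates, numerator data, absorption of the
binomial factors, top-coefficient stability).
-/

noncomputable section

open Complex Polynomial

namespace Summit.Schanuel.Schanuel.Theorems.RootDecomp1KGeneric

open Summit.Schanuel.Schanuel.Theorems.RootDecomp1KHyper
open Summit.Schanuel.Schanuel.Theorems.RootDecomp1KHyper.HyperCell

/-! ## KS 8. Budget lemmas for the main theorem -/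

/-- A polynomial with a support point has length `lenMv P ≥ 1`. -/
theorem one_le_lenMv (P : MvPolynomial (Fin 3) ℤ) {t : Fin 3 →₀ ℕ} (ht : t ∈ P.support) :
    1 ≤ lenMv P := by
  unfold lenMv
  have h1 : 1 ≤ |P.coeff t| := Int.one_le_abs (MvPolynomial.mem_support_iff.mp ht)
  exact h1.trans (Finset.single_le_sum (f := fun s => |P.coeff s|) (fun _ _ => abs_nonneg _) ht)

variable {L : ℕ} in
/-- Length bound for a specialised relation: `relLen (l ↦ kspec (Q l) D p q) ≤ (Σ_l lenMv (Q l)) · (p + q)^D`. -/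
theorem relLen_kspec_le (Q : Fin (L + 1) → MvPolynomial (Fin 3) ℤ) {D : ℕ}
    (hD : ∀ l, ∀ s ∈ (Q l).support, s 1 ≤ D) (p q : ℕ) :
    relLen (fun l => kspec (Q l) D p q) ≤ (∑ l, (lenMv (Q l) : ℝ)) * ((p : ℝ) + q) ^ D := by
  rw [relLen, Finset.sum_mul]
  refine Finset.sum_le_sum fun l _ => ?_
  have := len_kspec_le (Q l) (hD l) p q
  exact_mod_cast this

/-- `ε_{m+2} ≤ ε_m / 2`. -/
theorem exp_neg_pow_add_two_le_half {Q : ℝ} (hQ : 2 ≤ Q) (m : ℕ) :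
    Real.exp (-(Q ^ (m + 2))) ≤ Real.exp (-(Q ^ m)) / 2 := by
  have h1 : Q ^ m + 1 ≤ Q ^ (m + 2) := by
    have hm : 1 ≤ Q ^ m := one_le_pow₀ (by linarith)
    have hQ2 : 4 ≤ Q ^ 2 := by nlinarith
    calc Q ^ m + 1 ≤ Q ^ m * 4 := by linarith
      _ ≤ Q ^ m * Q ^ 2 := by gcongr
      _ = Q ^ (m + 2) := by rw [← pow_add]
  have h2 : (2 : ℝ) ≤ Real.exp 1 := by linarith [Real.add_one_le_exp (1 : ℝ)]
  rw [le_div_iff₀ (by norm_num : (0 : ℝ) < 2)]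
  have h1' : -(Q ^ (m + 2)) ≤ -(Q ^ m + 1) := by linarith
  calc Real.exp (-(Q ^ (m + 2))) * 2 ≤ Real.exp (-(Q ^ m + 1)) * Real.exp 1 := by
        gcongr
    _ = Real.exp (-(Q ^ m)) := by rw [← Real.exp_add]; ring_nf

/-- Root separation for `β`: `x^L ≤ ε_{m+1}` with `L + 1 ≤ Q` forces `x < ε_m / 2`. -/
theorem lt_half_eps_of_pow_le {x Q : ℝ} {L m : ℕ} (_hL : 0 < L) (hLQ : (L : ℝ) + 1 ≤ Q)
    (hm : 1 ≤ m) (_hx0 : 0 ≤ x) (hx : x ^ L ≤ Real.exp (-(Q ^ (m + 1)))) :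
    x < Real.exp (-(Q ^ m)) / 2 := by
  have hQ1 : (1 : ℝ) ≤ Q := by linarith [Nat.cast_nonneg (α := ℝ) L]
  by_contra hcon
  push Not at hcon
  have h1 : (Real.exp (-(Q ^ m)) / 2) ^ L ≤ x ^ L := pow_le_pow_left₀ (by positivity) hcon _
  -- (ε_m / 2)^L = exp(−L Q^m) / 2^L > exp(−Q^{m+1})
  have h2 : Real.exp (-(Q ^ (m + 1))) < (Real.exp (-(Q ^ m)) / 2) ^ L := by
    rw [div_pow, ← Real.exp_nat_mul, lt_div_iff₀ (by positivity)]
    have h2L : (2 : ℝ) ^ L ≤ Real.exp L := by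
      have : (2 : ℝ) ≤ Real.exp 1 := by linarith [Real.add_one_le_exp (1 : ℝ)]
      calc (2 : ℝ) ^ L ≤ (Real.exp 1) ^ L := pow_le_pow_left₀ (by norm_num) this _
        _ = Real.exp L := by rw [← Real.exp_nat_mul, mul_one]
    have hQm : Q ≤ Q ^ m := by
      calc Q = Q ^ 1 := (pow_one Q).symm
        _ ≤ Q ^ m := pow_le_pow_right₀ hQ1 hm
    have h3 : (L : ℝ) + L * Q ^ m < Q ^ (m + 1) := by
      rw [pow_succ]
      have hQm0 : 0 < Q ^ m := by positivity
      nlinarith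
    calc Real.exp (-(Q ^ (m + 1))) * 2 ^ L ≤ Real.exp (-(Q ^ (m + 1))) * Real.exp L := by gcongr
      _ = Real.exp (-(Q ^ (m + 1)) + L) := by rw [Real.exp_add]
      _ < Real.exp ((L : ℝ) * -(Q ^ m)) := by rw [Real.exp_lt_exp]; linarith
  linarith [h2.trans_le (h1.trans hx)]

/-- Root separation for `γ`: `δ^{n} ≤ v < ε_{m+5}` with `n ≤ c q`, `c ≤ Q` forces `δ < ε_{m+3}`. -/
theorem lt_eps_of_pow_le {δ v Q : ℝ} {n c q m : ℕ} (hQ : Q = q) (hQ1 : 1 ≤ Q) (hcQ : (c : ℝ) ≤ Q)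
    (hn : n ≤ c * q) (_hδ0 : 0 ≤ δ) (hδ : δ ^ n ≤ v) (hv : v < Real.exp (-(Q ^ (m + 5)))) :
    δ < Real.exp (-(Q ^ (m + 3))) := by
  by_contra hcon
  push Not at hcon
  have hε0 : 0 ≤ Real.exp (-(Q ^ (m + 3))) := Real.exp_nonneg _
  have hε1 : Real.exp (-(Q ^ (m + 3))) ≤ 1 := by
    rw [Real.exp_le_one_iff, neg_nonpos]; positivity
  have h1 : Real.exp (-(Q ^ (m + 3))) ^ n ≤ δ ^ n := pow_le_pow_left₀ hε0 hcon _
  have h2 : Real.exp (-(Q ^ (m + 3))) ^ (c * q) ≤ Real.exp (-(Q ^ (m + 3))) ^ n :=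
    pow_le_pow_of_le_one hε0 hε1 hn
  have h3 : Real.exp (-(Q ^ (m + 5))) ≤ Real.exp (-(Q ^ (m + 3))) ^ (c * q) := by
    rw [← Real.exp_nat_mul, Real.exp_le_exp]
    have h4 : ((c * q : ℕ) : ℝ) * Q ^ (m + 3) ≤ Q ^ (m + 5) := by
      push_cast
      rw [← hQ, show m + 5 = m + 3 + 2 by omega, pow_add Q (m + 3) 2, sq]
      have h0 : (0 : ℝ) ≤ Q := by linarith
      calc (c : ℝ) * Q * Q ^ (m + 3) = c * (Q * Q ^ (m + 3)) := by ring
        _ ≤ Q * (Q * Q ^ (m + 3)) := by gcongr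
        _ = Q ^ (m + 3) * (Q * Q) := by ring
    linarith
  linarith [h3.trans (h2.trans h1), hδ.trans_lt hv]

/-- **Size budget.**  The bound `pairSize f S ≤ q^{4E+16}`. -/
theorem budget_pairSize {Q MS Mf MrA Mr1 RH : ℝ} {E L q c nA n₁ N dS df : ℕ}
    (hQ3 : 3 ≤ Q) (hQq : Q = q) (hc : (c : ℝ) * q ≤ Q ^ 3) (hL : (L : ℝ) ≤ Q)
    (hnA : nA ≤ c * q) (hn₁ : n₁ ≤ nA) (hN : N ≤ c * q) (hdS : dS ≤ nA) (hdf : df ≤ n₁ * L)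
    (hMS1 : 1 ≤ MS) (hMS : MS ≤ 2 ^ nA * MrA ^ q) (hMrA1 : 1 ≤ MrA) (hMrA : MrA ≤ Q ^ (2 * E + 1))
    (hMf1 : 1 ≤ Mf) (hMf : Mf ≤ RH ^ n₁ * Mr1 ^ N) (hRH1 : 1 ≤ RH) (hRH : RH ≤ Q ^ (2 * E + 1))
    (hMr11 : 1 ≤ Mr1) (hMr1 : Mr1 ≤ MrA) :
    (((dS * df : ℕ) : ℝ)) * (1 + Real.log MS) * (1 + Real.log Mf) ≤ Q ^ (4 * E + 16) := by
  have hQ1 : (1 : ℝ) ≤ Q := by linarith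
  have hQ0 : (0 : ℝ) ≤ Q := by linarith
  have hnAQ : (nA : ℝ) ≤ Q ^ 3 := by
    calc (nA : ℝ) ≤ (c : ℝ) * q := by exact_mod_cast hnA
      _ ≤ Q ^ 3 := hc
  have hNQ : (N : ℝ) ≤ Q ^ 3 := by
    calc (N : ℝ) ≤ (c : ℝ) * q := by exact_mod_cast hN
      _ ≤ Q ^ 3 := hc
  have hn₁Q : (n₁ : ℝ) ≤ Q ^ 3 := le_trans (by exact_mod_cast hn₁) hnAQ
  -- degrees
  have hdeg : (((dS * df : ℕ) : ℝ)) ≤ Q ^ 7 := by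
    have h1 : (dS : ℝ) ≤ Q ^ 3 := le_trans (by exact_mod_cast hdS) hnAQ
    have h2 : (df : ℝ) ≤ Q ^ 3 * Q := by
      calc (df : ℝ) ≤ (n₁ : ℝ) * L := by exact_mod_cast hdf
        _ ≤ Q ^ 3 * Q := by gcongr
    push_cast
    calc (dS : ℝ) * df ≤ Q ^ 3 * (Q ^ 3 * Q) := by gcongr
      _ = Q ^ 7 := by ring
  -- log M(S)
  have hlog2 : Real.log 2 ≤ 1 := by
    have := Real.log_le_sub_one_of_pos (show (0:ℝ) < 2 by norm_num); linarith
  have hMrA0 : 0 < MrA := by linarith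
  have hlogS : 1 + Real.log MS ≤ Q ^ (2 * E + 4) := by
    have h1 : Real.log MS ≤ nA * Real.log 2 + q * Real.log MrA := by
      calc Real.log MS ≤ Real.log (2 ^ nA * MrA ^ q) := Real.log_le_log (by linarith) hMS
        _ = nA * Real.log 2 + q * Real.log MrA := by
            rw [Real.log_mul (by positivity) (by positivity), Real.log_pow, Real.log_pow]
    have h2 : Real.log MrA ≤ MrA := by linarith [Real.log_le_sub_one_of_pos hMrA0]
    have h3 : Real.log MS ≤ Q ^ 3 + Q * Q ^ (2 * E + 1) := by
      calc Real.log MS ≤ nA * Real.log 2 + q * Real.log MrA := h1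
        _ ≤ Q ^ 3 * 1 + Q * MrA := by
            rw [← hQq]
            have := Real.log_nonneg hMrA1
            gcongr
        _ ≤ Q ^ 3 * 1 + Q * Q ^ (2 * E + 1) := by gcongr
        _ = Q ^ 3 + Q * Q ^ (2 * E + 1) := by ring
    have h4 : Q ^ 3 ≤ Q ^ (2 * E + 3) := pow_le_pow_right₀ hQ1 (by omega)
    have h5 : Q * Q ^ (2 * E + 1) ≤ Q ^ (2 * E + 3) := by
      rw [← pow_succ']; exact pow_le_pow_right₀ hQ1 (by omega)
    have h6 : (1 : ℝ) ≤ Q ^ (2 * E + 3) := one_le_pow₀ hQ1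
    calc 1 + Real.log MS ≤ 3 * Q ^ (2 * E + 3) := by linarith
      _ ≤ Q * Q ^ (2 * E + 3) := by gcongr
      _ = Q ^ (2 * E + 4) := by rw [← pow_succ']
  -- log M(f)
  have hMr10 : 0 < Mr1 := by linarith
  have hRH0 : 0 < RH := by linarith
  have hlogf : 1 + Real.log Mf ≤ Q ^ (2 * E + 5) := by
    have h1 : Real.log Mf ≤ n₁ * Real.log RH + N * Real.log Mr1 := by
      calc Real.log Mf ≤ Real.log (RH ^ n₁ * Mr1 ^ N) := Real.log_le_log (by linarith) hMf
        _ = n₁ * Real.log RH + N * Real.log Mr1 := by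
            rw [Real.log_mul (by positivity) (by positivity), Real.log_pow, Real.log_pow]
    have h2 : Real.log RH ≤ RH := by linarith [Real.log_le_sub_one_of_pos hRH0]
    have h2' : Real.log Mr1 ≤ MrA := by linarith [Real.log_le_sub_one_of_pos hMr10]
    have h3 : Real.log Mf ≤ Q ^ 3 * Q ^ (2 * E + 1) + Q ^ 3 * Q ^ (2 * E + 1) := by
      calc Real.log Mf ≤ n₁ * Real.log RH + N * Real.log Mr1 := h1
        _ ≤ Q ^ 3 * RH + Q ^ 3 * MrA := by
            gcongr
            · exact Real.log_nonneg hRH1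
            · exact Real.log_nonneg hMr11
        _ ≤ Q ^ 3 * Q ^ (2 * E + 1) + Q ^ 3 * Q ^ (2 * E + 1) := by gcongr
    have h4 : Q ^ 3 * Q ^ (2 * E + 1) = Q ^ (2 * E + 4) := by rw [← pow_add]; ring_nf
    have h6 : (1 : ℝ) ≤ Q ^ (2 * E + 4) := one_le_pow₀ hQ1
    calc 1 + Real.log Mf ≤ 3 * Q ^ (2 * E + 4) := by rw [h4] at h3; linarith
      _ ≤ Q * Q ^ (2 * E + 4) := by gcongr
      _ = Q ^ (2 * E + 5) := by rw [← pow_succ']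
  have hlS0 : 0 ≤ 1 + Real.log MS := by linarith [Real.log_nonneg hMS1]
  have hlf0 : 0 ≤ 1 + Real.log Mf := by linarith [Real.log_nonneg hMf1]
  calc (((dS * df : ℕ) : ℝ)) * (1 + Real.log MS) * (1 + Real.log Mf)
      ≤ Q ^ 7 * Q ^ (2 * E + 4) * Q ^ (2 * E + 5) := by gcongr
    _ = Q ^ (4 * E + 16) := by rw [← pow_add, ← pow_add]; ring_nf
/-! ## KS 9. Extracted steps of the main proof (generic lemmas) -/

variable {L : ℕ} in
/-- A common bound `E ≥ 1` for all exponents of `P₁` and of the `Q l`. -/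
theorem exists_common_degree_bound (P₁ : MvPolynomial (Fin 3) ℤ)
    (Q : Fin (L + 1) → MvPolynomial (Fin 3) ℤ) :
    ∃ E : ℕ, (∀ s ∈ P₁.support, ∀ i, s i ≤ E) ∧ (∀ l, ∀ s ∈ (Q l).support, ∀ i, s i ≤ E) ∧ 1 ≤ E := by
  refine ⟨Finset.univ.sup (fun i => MvPolynomial.degreeOf i P₁) +
    Finset.univ.sup (fun l => Finset.univ.sup fun i => MvPolynomial.degreeOf i (Q l)) + 1,
    ?_, ?_, by omega⟩
  · intro s hs i
    have h1 : s i ≤ MvPolynomial.degreeOf i P₁ := MvPolynomial.monomial_le_degreeOf i hs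
    have h2 : MvPolynomial.degreeOf i P₁ ≤ Finset.univ.sup (fun i => MvPolynomial.degreeOf i P₁) :=
      Finset.le_sup (f := fun i => MvPolynomial.degreeOf i P₁) (Finset.mem_univ i)
    omega
  · intro l s hs i
    have h1 : s i ≤ MvPolynomial.degreeOf i (Q l) := MvPolynomial.monomial_le_degreeOf i hs
    have h2 : MvPolynomial.degreeOf i (Q l) ≤
        Finset.univ.sup (fun i => MvPolynomial.degreeOf i (Q l)) :=
      Finset.le_sup (f := fun i => MvPolynomial.degreeOf i (Q l)) (Finset.mem_univ i)
    have h3 : Finset.univ.sup (fun i => MvPolynomial.degreeOf i (Q l)) ≤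
        Finset.univ.sup (fun l => Finset.univ.sup fun i => MvPolynomial.degreeOf i (Q l)) :=
      Finset.le_sup (f := fun l => Finset.univ.sup fun i => MvPolynomial.degreeOf i (Q l))
        (Finset.mem_univ l)
    omega

/-- Each entry of `![a, b, c]` has norm at most `‖a‖ + ‖b‖ + ‖c‖`. -/
theorem norm_vec3_le {a b c : ℂ} (i : Fin 3) : ‖![a, b, c] i‖ ≤ ‖a‖ + ‖b‖ + ‖c‖ := by
  have ha := norm_nonneg a; have hb := norm_nonneg b; have hc := norm_nonneg c
  fin_cases i
  · show ‖a‖ ≤ _; linarith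
  · show ‖b‖ ≤ _; linarith
  · show ‖c‖ ≤ _; linarith

/-- A point within total distance `≤ 1` of `y` has coordinates of norm `≤ M` if `‖y i‖ + 1 ≤ M`. -/
theorem norm_le_of_sum_sub_le {x y : Fin 3 → ℂ} {M B : ℝ} (hy : ∀ i, ‖y i‖ + 1 ≤ M)
    (hs : ∑ i, ‖x i - y i‖ ≤ B) (hB : B ≤ 1) (i : Fin 3) : ‖x i‖ ≤ M := by
  have h1 : ‖x i - y i‖ ≤ ∑ j, ‖x j - y j‖ :=
    Finset.single_le_sum (f := fun j => ‖x j - y j‖) (fun _ _ => norm_nonneg _) (Finset.mem_univ i)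
  have h2 : ‖x i‖ ≤ ‖y i‖ + ‖x i - y i‖ := by
    calc ‖x i‖ = ‖y i + (x i - y i)‖ := by rw [add_sub_cancel]
      _ ≤ ‖y i‖ + ‖x i - y i‖ := norm_add_le _ _
  linarith [hy i]

/-- The numerator `p ∈ ℕ` of a positive rational approximation `r` of `ρ > 0` and its size. -/
theorem natNum_of_close {ρ : ℝ} {r : ℚ} (h1 : |ρ - r| ≤ 1) (hρr : |ρ - r| < ρ) :
    ∃ p : ℕ, (p : ℤ) = r.num ∧ p + r.den ≤ (⌈ρ⌉₊ + 2) * r.den ∧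
      ((r : ℝ) : ℂ) = (p : ℂ) / (r.den : ℂ) ∧ (r : ℝ) = p / r.den := by
  have hr0 : (0 : ℝ) < r := by have h := (abs_lt.mp hρr).2; linarith
  have hnum : 0 < r.num := Rat.num_pos.mpr (by exact_mod_cast hr0)
  refine ⟨r.num.natAbs, Int.natAbs_of_nonneg hnum.le, ?_, ?_, ?_⟩
  · have hden : (0 : ℝ) < r.den := by exact_mod_cast r.den_pos
    have hr1 : (r : ℝ) ≤ ρ + 1 := by have h := (abs_le.mp h1).1; linarith
    have hrpq : (r : ℝ) = (r.num.natAbs : ℝ) / r.den := by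
      rw [Rat.cast_def]; congr 1; rw [← Int.cast_natCast, Int.natAbs_of_nonneg hnum.le]
    have hp : (r.num.natAbs : ℝ) ≤ ((⌈ρ⌉₊ : ℝ) + 1) * r.den := by
      rw [hrpq, div_le_iff₀ hden] at hr1
      exact hr1.trans (by gcongr; exact Nat.le_ceil ρ)
    have hp' : r.num.natAbs ≤ (⌈ρ⌉₊ + 1) * r.den := by exact_mod_cast hp
    calc r.num.natAbs + r.den ≤ (⌈ρ⌉₊ + 1) * r.den + r.den := by omega
      _ = (⌈ρ⌉₊ + 2) * r.den := by ring
  · rw [ratCast_eq_num_div_den]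
    congr 1
    rw [← Int.cast_natCast, Int.natAbs_of_nonneg hnum.le]
  · rw [Rat.cast_def]; congr 1; rw [← Int.cast_natCast, Int.natAbs_of_nonneg hnum.le]

/-- Absorption of the binomial factors: `(q W^q + p W^p) δ ≤ ε_{m+2}` when `δ ≤ ε_{m+3}`. -/
theorem two_powers_absorb {W Q δ : ℝ} {p q c m : ℕ} (hQ : Q = q) (hq4 : 4 ≤ q) (hm : 2 ≤ m)
    (hW : 1 ≤ W) (hp : p ≤ c * q) (hc : 1 ≤ c) (h2c : 2 * (c : ℝ) ≤ Q) (hcW : (c : ℝ) * W ≤ q)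
    (hδ0 : 0 ≤ δ) (hδ : δ ≤ Real.exp (-(Q ^ (m + 3)))) :
    ((q : ℝ) * W ^ q + p * W ^ p) * δ ≤ Real.exp (-(Q ^ (m + 2))) := by
  have hQ0 : (0 : ℝ) ≤ Q := by rw [hQ]; positivity
  have h1c : (1 : ℝ) ≤ c := by exact_mod_cast hc
  have hQ2 : (2 : ℝ) ≤ Q := by linarith
  have hQ1 : (1 : ℝ) ≤ Q := by linarith
  have hWcq : W ^ q ≤ W ^ (c * q) := pow_le_pow_right₀ hW (Nat.le_mul_of_pos_left q (by omega))
  have hWcp : W ^ p ≤ W ^ (c * q) := pow_le_pow_right₀ hW hp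
  have hpR : (p : ℝ) ≤ c * Q := by rw [hQ]; exact_mod_cast hp
  have hqR : (q : ℝ) ≤ c * Q := by rw [hQ]; exact_mod_cast (Nat.le_mul_of_pos_left q (by omega))
  have h1 : (q : ℝ) * W ^ q + p * W ^ p ≤ (2 * c * Q) * W ^ (c * q) := by
    have hW0 : (0 : ℝ) ≤ W ^ (c * q) := by positivity
    calc (q : ℝ) * W ^ q + p * W ^ p ≤ (c * Q) * W ^ (c * q) + (c * Q) * W ^ (c * q) := by
          gcongr
      _ = (2 * c * Q) * W ^ (c * q) := by ring
  have hB : (2 * c * Q) * W ^ (c * q) ≤ Real.exp (Q ^ (m + 2)) := by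
    have h2c' : (2 * (c : ℝ) * Q) ≤ Real.exp ((q : ℝ) ^ 2) := by
      refine le_trans ?_ (natPow_le_exp_sq (show 2 ≤ q by omega))
      rw [sq, ← hQ]; exact mul_le_mul_of_nonneg_right h2c hQ0
    have h := prod4_le_exp_pow hq4 (show 3 ≤ m + 2 by omega) (by positivity) (by positivity)
      zero_le_one zero_le_one h2c' (constPow_le_exp_sq hW hcW)
      (const_le_exp_sq (by rw [← hQ]; exact hQ1)) (const_le_exp_sq (by rw [← hQ]; exact hQ1))
    rw [mul_one, mul_one, ← hQ] at h
    exact h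
  calc ((q : ℝ) * W ^ q + p * W ^ p) * δ
      ≤ ((2 * c * Q) * W ^ (c * q)) * Real.exp (-(Q ^ (m + 3))) := by gcongr
    _ ≤ Real.exp (-(Q ^ (m + 2))) := absorb hQ2 hB

/-- The specialised top coefficient keeps half its size. -/
theorem half_le_norm_of_close {a b : ℂ} {κ ℓ Lip Q ε : ℝ} (hκ : κ = ‖b‖) (hκ0 : 0 < κ) (hQ : 0 < Q)
    (hℓ : 0 ≤ ℓ) (hLip : 0 ≤ Lip) (hd : ‖a - b‖ ≤ ℓ * (Lip * (2 * ε))) (hε : ε ≤ Q⁻¹)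
    (hth : 4 * ℓ * Lip / κ ≤ Q) : κ / 2 ≤ ‖a‖ := by
  have hd' : ‖a - b‖ ≤ κ / 2 := by
    refine hd.trans ?_
    calc ℓ * (Lip * (2 * ε)) ≤ ℓ * (Lip * (2 * Q⁻¹)) := by gcongr
      _ = (4 * ℓ * Lip / κ) * Q⁻¹ * (κ / 2) := by field_simp; ring
      _ ≤ Q * Q⁻¹ * (κ / 2) := by gcongr
      _ = κ / 2 := by rw [mul_inv_cancel₀ hQ.ne', one_mul]
  have := norm_sub_norm_le b a
  rw [norm_sub_rev] at hd'
  linarith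

/-- Rearrangement: `κ/2 · X ≤ A · (2ε)` with `κ > 0` gives `X ≤ (4A/κ) · ε`. -/
theorem le_of_half_mul_le {X κ A ε : ℝ} (hκ : 0 < κ) (hX : κ / 2 * X ≤ A * (2 * ε)) :
    X ≤ 4 * A / κ * ε := by
  have hκ2 : 0 < κ / 2 := by positivity
  rw [← le_div_iff₀' hκ2] at hX
  refine hX.trans (le_of_eq ?_)
  field_simp
  ring

/-- A rational with natural numerator `p` casts to `p / den` in `ℂ`. -/
theorem ratCast_eq_natDiv {r : ℚ} {p : ℕ} (hp : (p : ℤ) = r.num) :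
    ((r : ℝ) : ℂ) = (p : ℂ) / (r.den : ℂ) := by
  rw [ratCast_eq_num_div_den, ← hp]; push_cast; rfl

/-- Upper bound `‖exp(u/q)‖ ≤ exp ‖u‖` for `q ≥ 1`. -/
theorem norm_cexp_div_le (u : ℂ) {q : ℕ} (hq : 0 < q) : ‖cexp (u / q)‖ ≤ Real.exp ‖u‖ := by
  rw [Complex.norm_exp]
  refine Real.exp_le_exp.mpr ((Complex.re_le_norm _).trans ?_)
  rw [norm_div, Complex.norm_natCast]
  exact div_le_self (norm_nonneg _) (by exact_mod_cast hq)

/-- Lower bound `exp(−‖u‖) ≤ ‖exp(u/q)‖`. -/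
theorem exp_neg_norm_le_norm_cexp_div (u : ℂ) (q : ℕ) : Real.exp (-‖u‖) ≤ ‖cexp (u / q)‖ := by
  rw [Complex.norm_exp]
  refine Real.exp_le_exp.mpr ?_
  rcases Nat.eq_zero_or_pos q with hq | hq
  · subst hq; simp
  have h1 : |(u / q).re| ≤ ‖u / q‖ := Complex.abs_re_le_norm _
  have h2 : ‖u / (q : ℂ)‖ ≤ ‖u‖ := by
    rw [norm_div, Complex.norm_natCast]
    exact div_le_self (norm_nonneg _) (by exact_mod_cast hq)
  linarith [(abs_le.mp h1).1]

end Summit.Schanuel.Schanuel.Theorems.RootDecomp1KGeneric
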